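import Literature.Probability.LatticeModels.CriticalWickDichotomy
import Literature.Probability.LatticeModels.CriticalScalingDimension
import Literature.MathematicalPhysics.QuantumFieldTheory.PointwiseOSReconstruction
import Literature.Barriers.CriticalPhenomena.ScaleCovarianceNotMoebius
import Summits.CriticalPhenomena.Ising3DConformalLimit.Theses.HyperoctahedralRP
import Summits.CriticalPhenomena.Ising3DConformalLimit.Theorems.InversionUpgradeNormalised.Negative.SharperWindow

/-!
# Skeleton of line `free-endpoint-gaussian-closure` for crux `InversionUpgradeNormalised`
(stmt-CriticalPhenomena-1982; route `HyperoctahedralRP`, shared by 8 routes) — LEAD'S RESHAPE (lead -1, gen 1)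

Crux (FIXED, concluded BY NAME below by `InversionUpgradeNormalised_of`):
`HyperoctahedralRP.InversionUpgradeNormalised` — every normalised (`S = 0` off `NonCoincident`),
non-degenerate, Euclidean-invariant, scale-covariant (weight `Δ`) pointwise scaling limit `S` of
`criticalCorr 3` is inversion covariant with the same `Δ`.

## The line and the lead's reshape (7 registered stubs; composition sorry-free)

STRATIFY the crux by the forced window `Δ ∈ [1/2, 3/4]` (`delta_mem_sharpWindow_of_hyp`, landed
`Negative/SharperWindow.lean`: infrared bound + Duminil-Copin–Panis 2025) and by the Aizenman–Newman
Gaussian dichotomy (`CriticalWickDichotomy`). The GAUSSIAN LOCUS (`U₄ ≡ 0` off diagonals) is closed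
sorry-free (`gaussianFamilyInversionCovariant`, planner/ideator 2). The two OS inputs every
interior mechanism needs — the OS premises of the limit along all three axes and clustering — are
MANUFACTURED here from the lattice, split by the lead into six worker-sized registered stubs:

* `stub_latticeRP` (lattice, M): site-mirror reflection positivity of `criticalCorr 3` through the
  three coordinate planes `{k_τ = 0}` (closed half-lattice), from the tree's finite-volume free RP
  `isingExpect_free_reflect_mul_self_nonneg` on the mirror-stable boxes + `criticalCorr_wellDefined_holds`.
* `stub_gaussianDomination` (limit form, M): `S_{2n} ≤ 𝒢_n[S₂]` on non-coincident configurations,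
  from `aizenman_nPoint_le_pairingSum_finite_holds` through the free box limits and `ρ^{2n} ≥ 0`.
* `stub_pairTruncation` (limit form, M/L): `0 ≤ S_{p+q}(x,y) - S_p(x)S_q(y)` (GKS II) and
  Glimm–Jaffe Cor. 4.3.3, `2(S_{p+q}(x,y) - S_p(x)S_q(y)) ≤ Σ_{odd I ⊆ [p], odd J ⊆ [q]} S(x_I,y_J) S(x_{Iᶜ},y_{Jᶜ})`
  for even `p, q`, from `plusCorr_mul_le` and `plusCorr_two_mul_cov_le_sum_odd_of_free_eq_plus`.
* `stub_osReflectionPositive` (M): `stub_latticeRP-stmt → (H1) → (H2) → translation invariance →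
  ∀ τ, IsReflectionPositiveAlong τ S`. RP passes to the pointwise limit after the HALF-MESH DIAGONAL
  SHIFT `z ↦ z + (δ/2)e_τ` (then `⌊·/δ⌋` is exactly mirror-symmetric for every `δ` off a countable
  set, and `S` is blind to the shift by translation invariance — no continuity of `S` needed).
* `stub_osLayer` (M): `stub_gaussianDomination-stmt → crux hyps → ∀ τ, IsReflectionPositiveAlong τ S →
  PointwiseOSReconstruction τ S`: reflection/translation invariance are (H5); permutation symmetry is
  exact on the lattice; polynomial (indeed bounded) time growth from Gaussian domination +
  `S₂ = C‖·‖^{-2Δ}`.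
* `stub_clustering` (M/L): `stub_gaussianDomination-stmt → stub_pairTruncation-stmt → crux hyps →
  S_{n+m}(x, y+tv) - S_n(x)S_m(y) → 0`: odd|odd blocks decay because every Wick term of an odd|odd
  split has a cross factor `S₂(xᵢ, yⱼ+tv) = O(t^{-2Δ})`; even|even blocks by pair truncation; mixed
  parity and `n = 0` are automatic (`m*(β_c) = 0`, `S₀ = 1`).
* `stub_interiorInversionUpgrade` (XXL = the crux on the non-Gaussian stratum; GRAFT POINT, held by
  the lead): crux hyps + `1/2 ≤ Δ ≤ 3/4` + `HasNontrivialU4 S` + OS ∀τ + clustering ⇒ inversion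
  covariance. No mechanism is claimed; the landed bridge
  `InversionUpgradeNormalised_of_ratioInversionInvariance` (stmt-4840 ⇒ crux) plugs in here. Its
  `Δ = 1/2` slice is the idea's free endpoint (`FreeEndpointWick`: Pohlmeyer 1969 would make the
  hypotheses contradictory) — folded in, since the tree has neither the distributional OS layer nor
  Pohlmeyer's theorem; recorded as named-fact-level debt in the lead's census.

`InversionUpgradeNormalised_of` composes the seven stubs into the crux BY NAME (kernel-checked; the
only `sorry`s of the file are the seven `stub_*` bodies; `crux_of_stubs` is the pure-logic lemma).

## Disproof used (Disproof.lean v7, cdisprove cycle 2; Negative/* landed)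
* `crux_iff_evenFromFour` / `crux_iff_sharpWindow`: `n = 0, 2`, odd `n`, coincident locus handled
  inside `gaussianFamilyInversionCovariant`; window `[1/2, 3/4]` handed to the interior stub.
* `¬WithoutIsingLimit` (H2 load-bearing ∀Δ>0, generic lattice provenance empty): (H2) is CONSUMED as
  `criticalCorr`-specific facts narrowFamily lacks — RP (`narrowFamily_not_reflectionPositive`, §6),
  GJ 4.3.3 / Gaussian domination (random-current/Lebowitz structure), `m*(β_c) = 0`.
* §5 (MMS/reflection MONOTONICITY inside the blocked class): not used anywhere in this line.
* §7 SixPt (`fourPoint_does_not_propagate`): this line never argues order-by-order; the Gaussian locus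
  is closed at all orders by Wick, the interior stub asks for `IsInversionCovariant` (all orders).
* §7' `rpDecoyInWindow` (open): if an RP decoy with Δ ≤ 3/4 exists, `stub_interiorInversionUpgrade`
  cannot be proved from OS + symmetry + window alone — which is why it keeps (H2) and clustering.
-/

noncomputable section

open Filter Topology
open Literature.Probability.LatticeModels Literature.MathematicalPhysics.QuantumFieldTheory
open EuclideanGeometry

namespace Summit.CriticalPhenomena.Ising3DConformalLimit.Cruxes.InversionUpgradeNormalised.FreeEndpointGaussianClosure

/-! ### The seven registered stubs (def-free signatures over tree declarations) -/

/-- **STUB 1 (M, lattice) — `stub_latticeRP`.** Site-mirror reflection positivity of the critical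
Ising correlators on `ℤ³` through each coordinate plane `{k_τ = 0}`: for finitely many lattice
configurations `z^a` in the CLOSED half-lattice `{k_τ ≥ 0}` and real coefficients `c_a`,
`Σ_{a,b} c_a c_b ⟨σ_{θ_τ z^a} σ_{z^b}⟩_{β_c} ≥ 0`, `θ_τ` negating the `τ`-coordinate (spin monomials,
multiplicities allowed). Intended proof: `F := Σ_a c_a spinMonomial (z^a)` is bounded, measurable and
depends on spins in `P = {k_τ ≥ 0}`; `(F∘θ*)·F = Σ c_a c_b spinMonomial (θ∘z^a ++ z^b)`
(`spinMonomial_append`); `0 ≤ ⟨(F∘θ*)F⟩^∅_{box 3 L}` by `isingExpect_free_reflect_mul_self_nonneg`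
(`zdGraph 3`, `θ` = coordinate negation as an `Equiv`, boxes `θ`-stable, H1–H3 of FILS site
geometry: an edge leaving `P` joins `k_τ = 0` to `k_τ = -1` and its reflection lies in `P`); expand by
linearity and let `L → ∞` with `criticalCorr_wellDefined_holds` (free b.c.), `ge_of_tendsto`.
[cite: FILS1978, §2; FriedliVelenik2017, Lemma 10.8] -/
theorem stub_latticeRP :
    ∀ (τ : Fin 3) (m : ℕ) (k : Fin m → ℕ) (z : (a : Fin m) → Fin (k a) → Site 3) (c : Fin m → ℝ),
      (∀ a i, 0 ≤ z a i τ) →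
      0 ≤ ∑ a, ∑ b, c a * c b *
        criticalCorr 3 (k a + k b)
          (Fin.append (fun i => Function.update (z a i) τ (-(z a i τ))) (z b)) := by
  sorry

/-- **STUB 2 (M, limit form) — `stub_gaussianDomination`.** Gaussian domination survives the scaling
limit: for every pointwise scaling limit `S` of `criticalCorr 3` (any `ρ > 0` on `(0,1]`), every `n`
and every non-coincident `x : Fin (2n) → ℝ³`, `S_{2n}(x) ≤ 𝒢_n[S₂](x) = pairingSum (S₂) n x`.
Intended proof: finite volume `aizenman_nPoint_le_pairingSum_finite_holds` (free b.c., `n ≥ 2`) →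
box limit (`criticalCorr_wellDefined_holds`, pattern of `abs_criticalCorr_sub_pairingSum_le`) →
multiply by `ρ(δ)^{2n} = (ρ(δ)²)ⁿ ≥ 0` (pairing products have `n` factors) → `δ → 0⁺` with
`tendsto_pairingSum` at the non-coincident sub-pairs; `n = 0`: `S₀ = 1 = 𝒢₀`; `n = 1`: equality
(permutation symmetry of `S₂` from the lattice). [cite: AizenmanCMP1982, Prop. 12.1; Newman1975] -/
theorem stub_gaussianDomination :
    ∀ (ρ : ℝ → ℝ) (S : CorrFamily 3), (∀ δ ∈ Set.Ioc (0:ℝ) 1, 0 < ρ δ) →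
      HasPointwiseScalingLimit (criticalCorr 3) ρ S →
      ∀ (n : ℕ) (x : Fin (2 * n) → EuclideanSpace ℝ (Fin 3)), x ∈ NonCoincident 3 (2 * n) →
        S (2 * n) x ≤ pairingSum (fun a b => S 2 ![a, b]) n x := by
  sorry

/-- **STUB 3 (M/L, limit form) — `stub_pairTruncation`.** GKS II and the Glimm–Jaffe pair-truncation
tree bound survive the scaling limit: for a pointwise limit `S` of `criticalCorr 3`, even `p, q` and an
injective appended configuration `(x, y)`,
`0 ≤ S_{p+q}(x,y) - S_p(x) S_q(y)` and
`2 (S_{p+q}(x,y) - S_p(x) S_q(y)) ≤ Σ_{I ⊆ [p] odd} Σ_{J ⊆ [q] odd} S_{|I|+|J|}(x_I, y_J) S(x_{Iᶜ}, y_{Jᶜ})`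
(sub-configurations enumerated increasingly by `Finset.orderEmbOfFin`). Intended proof: at mesh `δ`
small the lattice points `[x/δ], [y/δ]` are injective and disjoint; lower bound = `plusCorr_mul_le`
(GKS II, as in `criticalCorr_split_le` of the EvenPos file) times `ρ^p ρ^q`; upper bound =
`plusCorr_two_mul_cov_le_sum_odd_of_free_eq_plus` (free = plus at `β_c`, `d = 3`:
`freeCorr_eq_plusCorr_of_le_criticalBeta`) on `A = image [x/δ]`, `B = image [y/δ]` (disjoint, so
`∆ = ∪`), the odd subsets `A₁ ⊆ A` reindexed by odd `I ⊆ Fin p` through the injection, spin products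
= spin monomials of the sub-configurations (`spinMonomial_of_injective_eq_spinProduct`), times
`ρ^{p+q} = ρ^{|I|+|J|} ρ^{|Iᶜ|+|Jᶜ|}`; then `δ → 0⁺` termwise (`tendsto_at` at injective
sub-configurations). [cite: GlimmJaffe1987, Cor. 4.3.3; FriedliVelenik2017, Thm. 3.20] -/
theorem stub_pairTruncation :
    ∀ (ρ : ℝ → ℝ) (S : CorrFamily 3), (∀ δ ∈ Set.Ioc (0:ℝ) 1, 0 < ρ δ) →
      HasPointwiseScalingLimit (criticalCorr 3) ρ S →
      ∀ (p q : ℕ) (x : Fin p → EuclideanSpace ℝ (Fin 3)) (y : Fin q → EuclideanSpace ℝ (Fin 3)),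
        Even p → Even q → Function.Injective (Fin.append x y) →
        0 ≤ S (p + q) (Fin.append x y) - S p x * S q y ∧
        2 * (S (p + q) (Fin.append x y) - S p x * S q y) ≤
          ∑ I ∈ (Finset.univ : Finset (Fin p)).powerset.filter (fun I => Odd I.card),
            ∑ J ∈ (Finset.univ : Finset (Fin q)).powerset.filter (fun J => Odd J.card),
              S (I.card + J.card)
                  (Fin.append (fun i => x (I.orderEmbOfFin rfl i)) (fun j => y (J.orderEmbOfFin rfl j))) *
                S (Iᶜ.card + Jᶜ.card)
                  (Fin.append (fun i => x (Iᶜ.orderEmbOfFin rfl i)) (fun j => y (Jᶜ.orderEmbOfFin rfl j))) := by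
  sorry

/-- **STUB 4 (M) — `stub_osReflectionPositive`.** Given the statement of STUB 1: every pointwise
scaling limit `S` of `criticalCorr 3` (`ρ > 0` on `(0,1]`) that is translation invariant is reflection
positive along each coordinate axis `τ` in the pointwise OS sense (`IsReflectionPositiveAlong τ S`:
`Σ c_i c_j S(θ_τ a_i, a_j) ≥ 0` over half-space configurations). Intended proof (no continuity of `S`
needed): for half-space configurations `a_1…a_k` and reals `c`, put `Z_{ij} = (θ_τ a_i, a_j)`
(injective, `osPointKernel_arg_injective`) and SHIFT by half a mesh, `Z^δ_{ij} = Z_{ij} + (δ/2)(e_τ,…,e_τ)`.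
For `δ` off the countable set `{p_τ/(m - ½) : m ∈ ℤ, p a point of some a_i}` one has
`⌊-u + ½⌋ = -⌊u + ½⌋` at `u = p_τ/δ` (`Int.floor_neg`, `Int.ceil = Int.floor + 1` off `ℤ`), so
`[Z^δ_{ij}/δ] = (θ_site [a^δ_i/δ], [a^δ_j/δ])` with `θ_site k = update k τ (-k τ)` and
`[a^δ_j/δ]_τ = ⌊u + ½⌋ ≥ 0`; STUB 1 with coefficients `c_i ρ(δ)^{n_i}` gives
`Σ c_i c_j ρ^{n_i+n_j} G([Z^δ_{ij}/δ]) ≥ 0`. By translation invariance `S(Z^δ_{ij}) = S(Z_{ij})`, and by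
LOCAL UNIFORM convergence at `Z_{ij} ∈ NonCoincident` (open) the rescaled correlator at the moving
point `Z^δ_{ij} → Z_{ij}` tends to `S(Z_{ij})` (`Metric.tendstoLocallyUniformlyOn_iff`). If the limit
form were `< 0` it would be `< 0` on some `(0, δ₀)`, which is not covered by a countable set
(`Set.Countable.measure_zero` vs `Real.volume_Ioo`). [cite: GlimmJaffe1987, §6.1 (OS3); FILS1978, §2] -/
theorem stub_osReflectionPositive :
    (∀ (τ : Fin 3) (m : ℕ) (k : Fin m → ℕ) (z : (a : Fin m) → Fin (k a) → Site 3) (c : Fin m → ℝ),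
      (∀ a i, 0 ≤ z a i τ) →
      0 ≤ ∑ a, ∑ b, c a * c b *
        criticalCorr 3 (k a + k b)
          (Fin.append (fun i => Function.update (z a i) τ (-(z a i τ))) (z b))) →
    ∀ (ρ : ℝ → ℝ) (S : CorrFamily 3), (∀ δ ∈ Set.Ioc (0:ℝ) 1, 0 < ρ δ) →
      HasPointwiseScalingLimit (criticalCorr 3) ρ S → IsTranslationInvariant S →
      ∀ τ : Fin 3, IsReflectionPositiveAlong τ S := by
  sorry

/-- **STUB 5 (M) — `stub_osLayer`.** Given the statement of STUB 2 and reflection positivity along `τ`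
(STUB 4): every normalised, non-degenerate, Euclidean-invariant, scale-covariant pointwise scaling limit
of `criticalCorr 3` satisfies ALL premises of the pointwise OS reconstruction along `τ`
(`PointwiseOSReconstruction τ S`). Intended proof of the remaining four fields: `θ_τ`-invariance =
(H5).2 at `axisReflection τ`; translation invariance = (H5).1; permutation symmetry: exact on the lattice
(`spinMonomial (k ∘ σ) = spinMonomial k` by `Equiv.prod_comp`, hence equal rescaled correlators at
`x ∘ σ` and `x`, `tendsto_nhds_unique`), `0 = 0` off `NonCoincident` by (H3); polynomial time growth with
`N = 0`: odd orders vanish (`HasPointwiseScalingLimit.eq_zero_of_odd` at the injective kernel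
configurations), even orders satisfy `0 < S_{2m}` (landed `InversionDefectInvolution.stub_evenPos`) and
`S_{2m} ≤ 𝒢_m[S₂]` (STUB 2, after `Fin.cast`), each factor `S₂(u,v) = ‖u-v‖^{-2Δ} S₂(0,e₀)`
(`InversionUpgradeNormalisedNegative.two_point_eq`; `Δ ∈ [1/2,1]`, `scalingDimension_mem_Icc_holds`) with
all pairwise distances in `(θ_τ a, T(t) b)`, `t ≥ 0`, bounded below by a `t`-independent `r₀ > 0` (inside
each block the distances do not depend on `t`; across, the `τ`-coordinates differ by `a_iτ + b_jτ + t`).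
[cite: GlimmJaffe1987, §6.1 Thm. 6.1.3; OsterwalderSchrader1973, §4.1 (4.8)] -/
theorem stub_osLayer :
    (∀ (ρ : ℝ → ℝ) (S : CorrFamily 3), (∀ δ ∈ Set.Ioc (0:ℝ) 1, 0 < ρ δ) →
      HasPointwiseScalingLimit (criticalCorr 3) ρ S →
      ∀ (n : ℕ) (x : Fin (2 * n) → EuclideanSpace ℝ (Fin 3)), x ∈ NonCoincident 3 (2 * n) →
        S (2 * n) x ≤ pairingSum (fun a b => S 2 ![a, b]) n x) →
    ∀ (ρ : ℝ → ℝ) (Δ : ℝ) (S : CorrFamily 3), (∀ δ ∈ Set.Ioc (0:ℝ) 1, 0 < ρ δ) →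
      HasPointwiseScalingLimit (criticalCorr 3) ρ S → (∀ n z, z ∉ NonCoincident 3 n → S n z = 0) →
      IsNondegenerateTwoPoint S → IsEuclideanInvariant S → IsScaleCovariant Δ S →
      ∀ τ : Fin 3, IsReflectionPositiveAlong τ S → PointwiseOSReconstruction τ S := by
  sorry

/-- **STUB 6 (M/L) — `stub_clustering`.** Given the statements of STUB 2 and STUB 3: clustering (OS4)
of every normalised, non-degenerate, Euclidean-invariant, scale-covariant pointwise limit of
`criticalCorr 3` in every direction `v ≠ 0`: `S_{n+m}(x, y + tv) - S_n(x) S_m(y) → 0` as `t → ∞`.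
Intended proof: WLOG `x, y` injective (else both terms vanish by (H3), `Fin.append_injective_iff`); for
`t ≥ t₀` the appended configuration is injective with all cross distances `≥ t‖v‖ - C` and all
internal distances `≥ r > 0`. `n + m` odd: everything is `0` (`HasPointwiseScalingLimit.eq_zero_of_odd`).
`n, m` odd: `0 ≤ S_{n+m} ≤ 𝒢[S₂]` (STUB 2, after `Fin.cast` to `Fin (2k)`), and EVERY ordering `τ` in
`pairingSum` has a pair `{τ(2j), τ(2j+1)}` with one index in the `x`-block and one in the `y`-block
(parity), whose factor is `S₂(xᵢ, yⱼ + tv) = ‖xᵢ - yⱼ - tv‖^{-2Δ} S₂(0,e₀) → 0`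
(`two_point_eq`, `Δ ≥ 1/2`), the other factors bounded; so `S_{n+m}(x, y+tv) → 0 = S_n(x) S_m(y)`.
`n, m` even: STUB 3 (two-sided) with `S_m(y + tv) = S_m(y)` (translation invariance); each odd|odd
term `S(x_I, y_J + tv) → 0` by the previous case and its cofactor is bounded (STUB 2). `n = 0` or
`m = 0`: `S₀ = 1` (`InversionUpgradeNormalisedNegative.limit_zero_eq_one`). [cite: GlimmJaffe1987, Cor. 4.3.3 and §19.3] -/
theorem stub_clustering :
    (∀ (ρ : ℝ → ℝ) (S : CorrFamily 3), (∀ δ ∈ Set.Ioc (0:ℝ) 1, 0 < ρ δ) →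
      HasPointwiseScalingLimit (criticalCorr 3) ρ S →
      ∀ (n : ℕ) (x : Fin (2 * n) → EuclideanSpace ℝ (Fin 3)), x ∈ NonCoincident 3 (2 * n) →
        S (2 * n) x ≤ pairingSum (fun a b => S 2 ![a, b]) n x) →
    (∀ (ρ : ℝ → ℝ) (S : CorrFamily 3), (∀ δ ∈ Set.Ioc (0:ℝ) 1, 0 < ρ δ) →
      HasPointwiseScalingLimit (criticalCorr 3) ρ S →
      ∀ (p q : ℕ) (x : Fin p → EuclideanSpace ℝ (Fin 3)) (y : Fin q → EuclideanSpace ℝ (Fin 3)),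
        Even p → Even q → Function.Injective (Fin.append x y) →
        0 ≤ S (p + q) (Fin.append x y) - S p x * S q y ∧
        2 * (S (p + q) (Fin.append x y) - S p x * S q y) ≤
          ∑ I ∈ (Finset.univ : Finset (Fin p)).powerset.filter (fun I => Odd I.card),
            ∑ J ∈ (Finset.univ : Finset (Fin q)).powerset.filter (fun J => Odd J.card),
              S (I.card + J.card)
                  (Fin.append (fun i => x (I.orderEmbOfFin rfl i)) (fun j => y (J.orderEmbOfFin rfl j))) *
                S (Iᶜ.card + Jᶜ.card)
                  (Fin.append (fun i => x (Iᶜ.orderEmbOfFin rfl i)) (fun j => y (Jᶜ.orderEmbOfFin rfl j)))) →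
    ∀ (ρ : ℝ → ℝ) (Δ : ℝ) (S : CorrFamily 3), (∀ δ ∈ Set.Ioc (0:ℝ) 1, 0 < ρ δ) →
      HasPointwiseScalingLimit (criticalCorr 3) ρ S → (∀ n z, z ∉ NonCoincident 3 n → S n z = 0) →
      IsNondegenerateTwoPoint S → IsEuclideanInvariant S → IsScaleCovariant Δ S →
      ∀ (n m : ℕ) (x : Fin n → EuclideanSpace ℝ (Fin 3)) (y : Fin m → EuclideanSpace ℝ (Fin 3))
        (v : EuclideanSpace ℝ (Fin 3)), v ≠ 0 →
        Tendsto (fun t : ℝ => S (n + m) (Fin.append x (fun j => y j + t • v)) - S n x * S m y)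
          atTop (𝓝 0) := by
  sorry

/-- **STUB 7 (XXL, THE HARDEST — GRAFT POINT, held by the lead) — `stub_interiorInversionUpgrade`.**
The crux restricted to the NON-GAUSSIAN stratum `U₄ ≢ 0` of the forced sharp window `1/2 ≤ Δ ≤ 3/4`,
WITH the OS premises along all three axes (STUBS 4–5) and clustering (STUB 6) supplied as hypotheses —
all theorems of this line, so an interior mechanism pays nothing for them. No mechanism is claimed here.
Its `Δ = 1/2` slice is the idea's FREE ENDPOINT: there Pohlmeyer's zero-mass Jost–Schroer theorem
(CMP 12 (1969) 204, unique vacuum = clustering) would make the hypotheses contradictory (`U₄ ≡ 0`),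
i.e. `FreeEndpointWick`; it is folded in here because the tree lacks the distributional OS layer and
Pohlmeyer's theorem (named-fact level, recorded in the lead's census), not because it is believed hard.
Typed ways to fill the interior: (i) the landed cross-route bridge
`InversionDefectInvolution.InversionUpgradeNormalised_of_ratioInversionInvariance`
(`CurrentConnectionInvariance.RatioInversionInvariance`, stmt-4840 ⇒ the whole crux); (ii) light-cone /
modular flow on the OS data (ModularBoosts, light-cone-hsm-special-conformal) using the unique vacuum;
(iii) a conformal-weight-sharpened positivity at order 4 + an all-orders propagation mechanism
(Disproof §7: four-point covariance alone does not propagate). Model-blind versions are false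
(`ScaleCovarianceNotMoebius`, `narrowFamily`, `sixFamily` — none RP); an RP decoy with `Δ ≤ 3/4`
(Disproof §7', open) would show that (H2) must be spent beyond RP + clustering.
[cite: DelamotteTissierWschebor2016, §5–6; Pohlmeyer1969, Thm. p. 204; PolandRychkovVichi2019, §I] -/
theorem stub_interiorInversionUpgrade :
    ∀ (ρ : ℝ → ℝ) (Δ : ℝ) (S : CorrFamily 3), (∀ δ ∈ Set.Ioc (0:ℝ) 1, 0 < ρ δ) →
      HasPointwiseScalingLimit (criticalCorr 3) ρ S → (∀ n z, z ∉ NonCoincident 3 n → S n z = 0) →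
      IsNondegenerateTwoPoint S → IsEuclideanInvariant S → IsScaleCovariant Δ S →
      1 / 2 ≤ Δ → Δ ≤ 3 / 4 → HasNontrivialU4 S →
      (∀ τ : Fin 3, PointwiseOSReconstruction τ S) →
      (∀ (n m : ℕ) (x : Fin n → EuclideanSpace ℝ (Fin 3)) (y : Fin m → EuclideanSpace ℝ (Fin 3))
        (v : EuclideanSpace ℝ (Fin 3)), v ≠ 0 →
        Tendsto (fun t : ℝ => S (n + m) (Fin.append x (fun j => y j + t • v)) - S n x * S m y)
          atTop (𝓝 0)) →
      IsInversionCovariant Δ S := by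
  sorry

/-! ### The Gaussian locus is inversion covariant (sorry-free; ideator 2 / planner, kept verbatim) -/

section GaussianProof

open Literature.Barriers.CriticalPhenomena Finset

/-- Two-point structure of a Euclidean-invariant, scale-covariant family: for `a ≠ b`,
`S₂(a,b) = ‖a - b‖^{-2Δ} · S₂(0,e₁)`. [folklore] -/
theorem two_point_eq {Δ : ℝ} {S : CorrFamily 3} (heuc : IsEuclideanInvariant S)
    (hsc : IsScaleCovariant Δ S) {a b : EuclideanSpace ℝ (Fin 3)} (hab : a ≠ b) :
    S 2 ![a, b] = ‖a - b‖ ^ (-(2 * Δ)) * S 2 ![0, EuclideanSpace.single 0 1] := by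
  set e : EuclideanSpace ℝ (Fin 3) := EuclideanSpace.single 0 1 with he
  have hne : ‖e‖ = 1 := by simp [he]
  set r : ℝ := ‖b - a‖ with hr
  have hr0 : 0 < r := norm_pos_iff.mpr (sub_ne_zero.mpr (Ne.symm hab))
  have h1 : S 2 ![a, b] = S 2 ![0, b - a] := by
    have h := heuc.1 2 (-a) ![a, b]
    rw [← h]
    congr 1
    funext i
    fin_cases i <;> simp [sub_eq_add_neg]
  have hnorm_eq : ‖b - a‖ = ‖r • e‖ := by
    rw [norm_smul, hne, mul_one, Real.norm_eq_abs, abs_of_pos hr0]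
  have hRv : Submodule.reflection (ℝ ∙ ((b - a) - r • e))ᗮ (b - a) = r • e :=
    Submodule.reflection_sub hnorm_eq
  have h2 : S 2 ![0, b - a] = S 2 ![0, r • e] := by
    have h := heuc.2 2 (Submodule.reflection (ℝ ∙ ((b - a) - r • e))ᗮ) ![0, b - a]
    rw [← h]
    congr 1
    funext i
    fin_cases i <;> simp [hRv]
  have h3 : S 2 ![0, r • e] = r ^ (-(2 * Δ)) * S 2 ![0, e] := by
    have h := hsc 2 r hr0 ![0, e]
    have hfun : (fun i => r • (![0, e] : Fin 2 → EuclideanSpace ℝ (Fin 3)) i) = ![0, r • e] := by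
      funext i
      fin_cases i <;> simp
    have hexp : (-((2 : ℕ) : ℝ) * Δ) = -(2 * Δ) := by push_cast; ring
    rw [hfun, hexp] at h
    exact h
  rw [h1, h2, h3, hr, norm_sub_rev]

/-- The two-point inversion law: `S₂(ιp, ιq) = ‖p‖^{2Δ}‖q‖^{2Δ} S₂(p, q)` for distinct non-zero
`p, q`. [folklore] -/
theorem two_point_inversion {Δ : ℝ} {S : CorrFamily 3} (heuc : IsEuclideanInvariant S)
    (hsc : IsScaleCovariant Δ S) {p q : EuclideanSpace ℝ (Fin 3)} (hpq : p ≠ q) (hp : p ≠ 0)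
    (hq : q ≠ 0) :
    S 2 ![inversion 0 1 p, inversion 0 1 q] = ‖p‖ ^ (2 * Δ) * ‖q‖ ^ (2 * Δ) * S 2 ![p, q] := by
  have hinj := inversion_injective (0 : EuclideanSpace ℝ (Fin 3)) one_ne_zero
  have hpq' : inversion 0 1 p ≠ inversion 0 1 q := fun h => hpq (hinj h)
  rw [two_point_eq heuc hsc hpq', two_point_eq heuc hsc hpq]
  have key := ScaleNotMoebius.twoPt_inversion Δ hp hq
  simp only [ScaleNotMoebius.twoPt] at key
  rw [key]
  ring

/-- Reindexing the Kelvin weights of a pairing. [folklore] -/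
theorem prod_pair_weights {α : Type*} (w : α → ℝ) (m : ℕ) (x : Fin (2 * m) → α)
    (τ : Equiv.Perm (Fin (2 * m))) :
    ∏ j : Fin m, (w (x (τ (pairIdx m (j, 0)))) * w (x (τ (pairIdx m (j, 1))))) =
      ∏ i, w (x i) := by
  calc ∏ j : Fin m, (w (x (τ (pairIdx m (j, 0)))) * w (x (τ (pairIdx m (j, 1)))))
      = ∏ j : Fin m, ∏ k : Fin 2, w (x (τ (pairIdx m (j, k)))) := by
        refine Finset.prod_congr rfl fun j _ => ?_
        rw [Fin.prod_univ_two]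
    _ = ∏ p : Fin m × Fin 2, w (x (τ (pairIdx m p))) := by
        rw [← Finset.univ_product_univ, Finset.prod_product]
    _ = ∏ i : Fin (2 * m), w (x (τ i)) :=
        Fintype.prod_equiv (pairIdx m) _ _ fun p => rfl
    _ = ∏ i, w (x i) := Equiv.prod_comp τ (fun i => w (x i))

/-- **The Gaussian locus is inversion covariant** (model-blind): a normalised, Euclidean-invariant,
scale-covariant family on `ℝ³` whose odd correlators vanish and whose even correlators obey Wick's
rule off the diagonals is inversion covariant with the same weight. [folklore] -/
theorem gaussianFamilyInversionCovariant {Δ : ℝ} {S : CorrFamily 3}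
    (hnorm : ∀ n z, z ∉ NonCoincident 3 n → S n z = 0) (heuc : IsEuclideanInvariant S)
    (hsc : IsScaleCovariant Δ S)
    (hodd : ∀ n (x : Fin n → EuclideanSpace ℝ (Fin 3)), Odd n → S n x = 0)
    (hwick : ∀ n, 2 ≤ n → ∀ x ∈ NonCoincident 3 (2 * n),
      S (2 * n) x = pairingSum (fun p q => S 2 ![p, q]) n x) :
    IsInversionCovariant Δ S := by
  intro n x hx0
  set ι : EuclideanSpace ℝ (Fin 3) → EuclideanSpace ℝ (Fin 3) := inversion 0 1 with hι
  have hinj : Function.Injective ι := inversion_injective (0 : EuclideanSpace ℝ (Fin 3)) one_ne_zero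
  obtain ⟨k, rfl | rfl⟩ := Nat.even_or_odd' n
  · by_cases hx : Function.Injective x
    · have hιx : Function.Injective (fun i => ι (x i)) := hinj.comp hx
      rcases k with _ | _ | k
      · have hi : ∀ i : Fin (2 * 0), False := fun i => by have := i.isLt; omega
        have hfun : (fun i => ι (x i)) = x := funext fun i => (hi i).elim
        rw [hfun, Finset.prod_eq_one (fun i _ => (hi i).elim), one_mul]
      · have hx01 : x 0 ≠ x 1 := fun h => absurd (hx h) (by decide)
        have hxv : x = ![x 0, x 1] := by funext i; fin_cases i <;> rfl
        have hιv : (fun i => ι (x i)) = ![ι (x 0), ι (x 1)] := by funext i; fin_cases i <;> rfl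
        rw [hιv, hxv]
        simp only [Matrix.cons_val_zero, Matrix.cons_val_one]
        rw [Fin.prod_univ_two]
        simp only [Matrix.cons_val_zero, Matrix.cons_val_one]
        exact two_point_inversion heuc hsc hx01 (hx0 0) (hx0 1)
      · have hk : 2 ≤ k + 2 := by omega
        rw [hwick (k + 2) hk _ hιx, hwick (k + 2) hk _ hx]
        unfold pairingSum
        rw [Finset.mul_sum, Finset.mul_sum, Finset.mul_sum]
        refine Finset.sum_congr rfl fun τ _ => ?_
        have hterm : ∀ j : Fin (k + 2),
            S 2 ![ι (x (τ (pairIdx (k + 2) (j, 0)))), ι (x (τ (pairIdx (k + 2) (j, 1))))] =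
              (‖x (τ (pairIdx (k + 2) (j, 0)))‖ ^ (2 * Δ) * ‖x (τ (pairIdx (k + 2) (j, 1)))‖ ^ (2 * Δ)) *
                S 2 ![x (τ (pairIdx (k + 2) (j, 0))), x (τ (pairIdx (k + 2) (j, 1)))] := by
          intro j
          have hne : x (τ (pairIdx (k + 2) (j, 0))) ≠ x (τ (pairIdx (k + 2) (j, 1))) := by
            intro h
            have h1 := τ.injective (hx h)
            have h2 := (pairIdx (k + 2)).injective h1
            simp at h2
          rw [two_point_inversion heuc hsc hne (hx0 _) (hx0 _)]
        simp_rw [hterm]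
        rw [Finset.prod_mul_distrib, prod_pair_weights (fun p => ‖p‖ ^ (2 * Δ)) (k + 2) x τ]
        ring
    · have hιx : ¬ Function.Injective (fun i => ι (x i)) := fun h => hx (hinj.of_comp_iff x |>.mp h)
      rw [hnorm _ _ hιx, hnorm _ _ hx, mul_zero]
  · rw [hodd _ _ ⟨k, rfl⟩, hodd _ _ ⟨k, rfl⟩, mul_zero]

end GaussianProof

/-! ### Composition: the seven stubs imply the crux, BY NAME -/

/-- Local alias of the crux, used ONLY as the conclusion of the pure-logic lemma `crux_of_stubs`. -/
abbrev Crux : Prop :=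
  Summit.CriticalPhenomena.Ising3DConformalLimit.Theses.HyperoctahedralRP.InversionUpgradeNormalised

/-- **Pure-logic composition (sorry-free).** `Δ ∈ [1/2, 3/4]` (`delta_mem_sharpWindow_of_hyp`);
STUB 1 feeds STUB 4 (RP along every axis), STUBS 2 + 4 feed STUB 5 (OS layer), STUBS 2–3 feed STUB 6
(clustering); on the Gaussian locus `U₄ ≡ 0` ⇒ Wick at all even orders
(`HasPointwiseScalingLimit.eq_pairingSum_of_limitConnectedFour_eq_zero`), odd orders vanish, and Wick
families are inversion covariant (`gaussianFamilyInversionCovariant`); otherwise `HasNontrivialU4 S` and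
STUB 7 applies with the OS layer and clustering in hand. -/
theorem crux_of_stubs
    (h1 : ∀ (τ : Fin 3) (m : ℕ) (k : Fin m → ℕ) (z : (a : Fin m) → Fin (k a) → Site 3) (c : Fin m → ℝ),
      (∀ a i, 0 ≤ z a i τ) →
      0 ≤ ∑ a, ∑ b, c a * c b *
        criticalCorr 3 (k a + k b)
          (Fin.append (fun i => Function.update (z a i) τ (-(z a i τ))) (z b)))
    (h2 : ∀ (ρ : ℝ → ℝ) (S : CorrFamily 3), (∀ δ ∈ Set.Ioc (0:ℝ) 1, 0 < ρ δ) →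
      HasPointwiseScalingLimit (criticalCorr 3) ρ S →
      ∀ (n : ℕ) (x : Fin (2 * n) → EuclideanSpace ℝ (Fin 3)), x ∈ NonCoincident 3 (2 * n) →
        S (2 * n) x ≤ pairingSum (fun a b => S 2 ![a, b]) n x)
    (h3 : ∀ (ρ : ℝ → ℝ) (S : CorrFamily 3), (∀ δ ∈ Set.Ioc (0:ℝ) 1, 0 < ρ δ) →
      HasPointwiseScalingLimit (criticalCorr 3) ρ S →
      ∀ (p q : ℕ) (x : Fin p → EuclideanSpace ℝ (Fin 3)) (y : Fin q → EuclideanSpace ℝ (Fin 3)),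
        Even p → Even q → Function.Injective (Fin.append x y) →
        0 ≤ S (p + q) (Fin.append x y) - S p x * S q y ∧
        2 * (S (p + q) (Fin.append x y) - S p x * S q y) ≤
          ∑ I ∈ (Finset.univ : Finset (Fin p)).powerset.filter (fun I => Odd I.card),
            ∑ J ∈ (Finset.univ : Finset (Fin q)).powerset.filter (fun J => Odd J.card),
              S (I.card + J.card)
                  (Fin.append (fun i => x (I.orderEmbOfFin rfl i)) (fun j => y (J.orderEmbOfFin rfl j))) *
                S (Iᶜ.card + Jᶜ.card)
                  (Fin.append (fun i => x (Iᶜ.orderEmbOfFin rfl i)) (fun j => y (Jᶜ.orderEmbOfFin rfl j))))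
    (h4 : (∀ (τ : Fin 3) (m : ℕ) (k : Fin m → ℕ) (z : (a : Fin m) → Fin (k a) → Site 3) (c : Fin m → ℝ),
      (∀ a i, 0 ≤ z a i τ) →
      0 ≤ ∑ a, ∑ b, c a * c b *
        criticalCorr 3 (k a + k b)
          (Fin.append (fun i => Function.update (z a i) τ (-(z a i τ))) (z b))) →
    ∀ (ρ : ℝ → ℝ) (S : CorrFamily 3), (∀ δ ∈ Set.Ioc (0:ℝ) 1, 0 < ρ δ) →
      HasPointwiseScalingLimit (criticalCorr 3) ρ S → IsTranslationInvariant S →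
      ∀ τ : Fin 3, IsReflectionPositiveAlong τ S)
    (h5 : (∀ (ρ : ℝ → ℝ) (S : CorrFamily 3), (∀ δ ∈ Set.Ioc (0:ℝ) 1, 0 < ρ δ) →
      HasPointwiseScalingLimit (criticalCorr 3) ρ S →
      ∀ (n : ℕ) (x : Fin (2 * n) → EuclideanSpace ℝ (Fin 3)), x ∈ NonCoincident 3 (2 * n) →
        S (2 * n) x ≤ pairingSum (fun a b => S 2 ![a, b]) n x) →
    ∀ (ρ : ℝ → ℝ) (Δ : ℝ) (S : CorrFamily 3), (∀ δ ∈ Set.Ioc (0:ℝ) 1, 0 < ρ δ) →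
      HasPointwiseScalingLimit (criticalCorr 3) ρ S → (∀ n z, z ∉ NonCoincident 3 n → S n z = 0) →
      IsNondegenerateTwoPoint S → IsEuclideanInvariant S → IsScaleCovariant Δ S →
      ∀ τ : Fin 3, IsReflectionPositiveAlong τ S → PointwiseOSReconstruction τ S)
    (h6 : (∀ (ρ : ℝ → ℝ) (S : CorrFamily 3), (∀ δ ∈ Set.Ioc (0:ℝ) 1, 0 < ρ δ) →
      HasPointwiseScalingLimit (criticalCorr 3) ρ S →
      ∀ (n : ℕ) (x : Fin (2 * n) → EuclideanSpace ℝ (Fin 3)), x ∈ NonCoincident 3 (2 * n) →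
        S (2 * n) x ≤ pairingSum (fun a b => S 2 ![a, b]) n x) →
    (∀ (ρ : ℝ → ℝ) (S : CorrFamily 3), (∀ δ ∈ Set.Ioc (0:ℝ) 1, 0 < ρ δ) →
      HasPointwiseScalingLimit (criticalCorr 3) ρ S →
      ∀ (p q : ℕ) (x : Fin p → EuclideanSpace ℝ (Fin 3)) (y : Fin q → EuclideanSpace ℝ (Fin 3)),
        Even p → Even q → Function.Injective (Fin.append x y) →
        0 ≤ S (p + q) (Fin.append x y) - S p x * S q y ∧
        2 * (S (p + q) (Fin.append x y) - S p x * S q y) ≤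
          ∑ I ∈ (Finset.univ : Finset (Fin p)).powerset.filter (fun I => Odd I.card),
            ∑ J ∈ (Finset.univ : Finset (Fin q)).powerset.filter (fun J => Odd J.card),
              S (I.card + J.card)
                  (Fin.append (fun i => x (I.orderEmbOfFin rfl i)) (fun j => y (J.orderEmbOfFin rfl j))) *
                S (Iᶜ.card + Jᶜ.card)
                  (Fin.append (fun i => x (Iᶜ.orderEmbOfFin rfl i)) (fun j => y (Jᶜ.orderEmbOfFin rfl j)))) →
    ∀ (ρ : ℝ → ℝ) (Δ : ℝ) (S : CorrFamily 3), (∀ δ ∈ Set.Ioc (0:ℝ) 1, 0 < ρ δ) →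
      HasPointwiseScalingLimit (criticalCorr 3) ρ S → (∀ n z, z ∉ NonCoincident 3 n → S n z = 0) →
      IsNondegenerateTwoPoint S → IsEuclideanInvariant S → IsScaleCovariant Δ S →
      ∀ (n m : ℕ) (x : Fin n → EuclideanSpace ℝ (Fin 3)) (y : Fin m → EuclideanSpace ℝ (Fin 3))
        (v : EuclideanSpace ℝ (Fin 3)), v ≠ 0 →
        Tendsto (fun t : ℝ => S (n + m) (Fin.append x (fun j => y j + t • v)) - S n x * S m y)
          atTop (𝓝 0))
    (h7 : ∀ (ρ : ℝ → ℝ) (Δ : ℝ) (S : CorrFamily 3), (∀ δ ∈ Set.Ioc (0:ℝ) 1, 0 < ρ δ) →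
      HasPointwiseScalingLimit (criticalCorr 3) ρ S → (∀ n z, z ∉ NonCoincident 3 n → S n z = 0) →
      IsNondegenerateTwoPoint S → IsEuclideanInvariant S → IsScaleCovariant Δ S →
      1 / 2 ≤ Δ → Δ ≤ 3 / 4 → HasNontrivialU4 S →
      (∀ τ : Fin 3, PointwiseOSReconstruction τ S) →
      (∀ (n m : ℕ) (x : Fin n → EuclideanSpace ℝ (Fin 3)) (y : Fin m → EuclideanSpace ℝ (Fin 3))
        (v : EuclideanSpace ℝ (Fin 3)), v ≠ 0 →
        Tendsto (fun t : ℝ => S (n + m) (Fin.append x (fun j => y j + t • v)) - S n x * S m y)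
          atTop (𝓝 0)) →
      IsInversionCovariant Δ S) :
    Crux := by
  intro ρ Δ S hρ hlim hnorm hnd heuc hsc
  have hΔ : Δ ∈ Set.Icc (1 / 2 : ℝ) (3 / 4) :=
    InversionUpgradeNormalisedNegative.delta_mem_sharpWindow_of_hyp hρ hlim hnd heuc hsc
  have hrp : ∀ τ : Fin 3, IsReflectionPositiveAlong τ S := h4 h1 ρ S hρ hlim heuc.1
  have hos : ∀ τ : Fin 3, PointwiseOSReconstruction τ S :=
    fun τ => h5 h2 ρ Δ S hρ hlim hnorm hnd heuc hsc τ (hrp τ)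
  have hcl : ∀ (n m : ℕ) (x : Fin n → EuclideanSpace ℝ (Fin 3))
      (y : Fin m → EuclideanSpace ℝ (Fin 3)) (v : EuclideanSpace ℝ (Fin 3)), v ≠ 0 →
      Tendsto (fun t : ℝ => S (n + m) (Fin.append x (fun j => y j + t • v)) - S n x * S m y)
        atTop (𝓝 0) :=
    h6 h2 h3 ρ Δ S hρ hlim hnorm hnd heuc hsc
  -- odd orders vanish everywhere (`m*(β_c) = 0` on non-coincident configurations, normalisation off)
  have hodd : ∀ n (x : Fin n → EuclideanSpace ℝ (Fin 3)), Odd n → S n x = 0 := by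
    intro n x hn
    by_cases hx : x ∈ NonCoincident 3 n
    · exact hlim.eq_zero_of_odd le_rfl hn hx
    · exact hnorm n x hx
  by_cases hU4 : HasNontrivialU4 S
  · -- the non-Gaussian stratum (interior incl. the free endpoint slice)
    exact h7 ρ Δ S hρ hlim hnorm hnd heuc hsc hΔ.1 hΔ.2 hU4 hos hcl
  · -- the Gaussian locus: Wick at every even order (Aizenman–Newman dichotomy, tree)
    have hU : ∀ z ∈ NonCoincident 3 4, limitConnectedFour S z = 0 := by
      intro z hz
      by_contra hne
      exact hU4 ⟨z, hz, hne⟩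
    have hwick : ∀ n, 2 ≤ n → ∀ x ∈ NonCoincident 3 (2 * n),
        S (2 * n) x = pairingSum (fun p q => S 2 ![p, q]) n x :=
      fun n hn x hx => hlim.eq_pairingSum_of_limitConnectedFour_eq_zero le_rfl hU hn hx
    exact gaussianFamilyInversionCovariant hnorm heuc hsc hodd hwick

/-- **The skeleton theorem: the line closes the crux BY NAME.** Hypothesis-free; its only
non-whitelisted axiom is the `sorryAx` of the declared stubs, fed to `crux_of_stubs`. -/
theorem InversionUpgradeNormalised_of :
    Summit.CriticalPhenomena.Ising3DConformalLimit.Theses.HyperoctahedralRP.InversionUpgradeNormalised :=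
  crux_of_stubs stub_latticeRP stub_gaussianDomination stub_pairTruncation stub_osReflectionPositive
    stub_osLayer stub_clustering stub_interiorInversionUpgrade

end Summit.CriticalPhenomena.Ising3DConformalLimit.Cruxes.InversionUpgradeNormalised.FreeEndpointGaussianClosure

end
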